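import Mathlib
import HarnessLib
import HarnessLib.Audit
import Summits.AtomisticToContinuum.Statement
import Literature.MathematicalPhysics.KineticTheory.LangevinChainKernel
import Literature.MathematicalPhysics.KineticTheory.LangevinChainGibbs
import Summits.AtomisticToContinuum.FouriersLaw.Theorems.EmbeddedDrudeMourreNessUnique
import Summits.AtomisticToContinuum.FouriersLaw.Theorems.FourierGreenKuboFourierFiniteResponseOfUnique
import Summits.AtomisticToContinuum.FouriersLaw.Theorems.ContactEchoEpochsPinnedSteadyStateExists
import HarnessLib.Audit.Status.Attr

/-!
Route: HeatModeWeylLaw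

DORMANT since 2026-08-22T07:30:02Z (reconciler: no traction for 5.2 d (last activity item-evidence-added at 2026-08-17T02:50:44Z); parked, not closed — `ledger route dormant route-AtomisticToContinuum-HeatModeWeylLaw --off` to reactivat) — unstaffed, not closed; items shared with open routes are served there. `ledger route dormant <id> --off` reactivates.

# Route HeatModeWeylLaw — Weyl law for heat — read κ = c_v·D_th off the N⁻² relaxation of the
equilibrium heat mode

X_W (WEYL LAW FOR THE HEAT MODE; realises idea card weyl-law-for-heat; D-0027 §2.1-conforming
re-open of the retired route WeylLawForHeat, whose assembly lacked a deciding theorem). Work at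
EQUILIBRIUM (both baths at T > 0) with objects already in tree: P = pinnedChain ω₂ lam β γ (all four
> 0), the Gibbs measure μ_N = P.gibbsMeasure N T, the CONSTRUCTED transition kernels K_t =
P.transitionKernel N T T t, the Dirichlet (k = 1) sine energy mode E_N = Σ_i sin(π(i+½)/N)·e_i (site
energies, bonds split symmetrically), its Gibbs variance V_N and autocorrelation c_N(t) = ∫ Ê_N·(K_t
Ê_N) dμ_N. It suffices to show X_W = L ∧ U ∧ W ∧ H: (L) HeatModeGap — c_N(t) ≤ A·e^(−rt/N²)·V_N,
N-uniform A, r (the heat mode relaxes at least diffusively fast: anharmonicity must remove the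
harmonic chain's slow N⁻³ phonon tail); (U) SineModeDiffusive — c_N(t) ≥ (1 − Ct/N²)·V_N (energy
spreads at most diffusively: finiteness); (W) WeylLimit — on the clock t = N²s, c_N(N²s)/V_N
converges into the one-parameter family e^(−π²D_th·s), D_th ∈ [0, ∞] (D_th = ∞ read as limit 0 for s
> 0); (H) EinsteinRelation — if the limit is e^(−π²D_th·s) with D_th > 0 and Var(H_N)/(NT²) → c_v
then BLR's response coefficients obey D_N → c_v·D_th. U excludes D_th = ∞, L forces D_th ≥ r/π² > 0,
so κ(T) := c_v(T)·D_th(T) ∈ (0, ∞) and clause (ii) of FouriersLawFor follows; clause (i) is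
PinnedSteadyStateExists (shared stmt-9900: existence, PROVED in tree as
pinnedChain_exists_isSteadyState and itemised by the 2026-08-15 route-repair so that this file does
not import the Langevin-SDE H2/Harris cone) plus NessUnique (shared stmt-0741); D_N exists by
FiniteResponseOfUnique (shared stmt-0717).
Lean: `HeatModeGap ∧ SineModeDiffusive ∧ WeylLimit ∧ EinsteinRelation`

## Assembly DECIDING THEOREM (D-0027 §2.1), supplied with `--closes-file glue.lean` and PROVED
sorry-free in the planner's Sketch.lean (lean check rc 0, ~90 lines, axioms
propext/Classical.choice/Quot.sound): `theorem closes : HeatModeGap → SineModeDiffusive → WeylLimit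
→ EinsteinRelation → SineModeBasics → SpecificHeatLimit → NessUnique → PinnedSteadyStateExists →
FiniteResponseOfUnique → FouriersLaw` — hypotheses are nine of this route's own items (route-repair
2026-08-15: PinnedSteadyStateExists replaces the direct call of the Literature theorem
pinnedChain_exists_isSteadyState; re-certified rc 0), conclusion the sub-problem Statement decl
`_root_.FouriersLaw` itself. Proof: clause (i) = PinnedSteadyStateExists (all N) + NessUnique.
Clause (ii) at T > 0: c_v from SpecificHeatLimit; D_th and its branch from WeylLimit; the branch "→
0 for all s > 0" contradicts SineModeDiffusive + SineModeBasics at s₀ = 1/(2(|C|+1)) (limit 0 versus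
c_N/V_N ≥ 1/2); in the other branch HeatModeGap at t = N²s gives c_N(N²s)/V_N ≤ A·e^(−rs), hence
e^(−π²D_th·s) ≤ A·e^(−rs) for all s ≥ 0 and D_th > 0; set κ(T) := c_v·D_th > 0 (κ := 1 off (0,∞));
for a steady-state family take D_N from FiniteResponseOfUnique and conclude D_N → κ(T) by
EinsteinRelation; glue the pointwise values into a function by choice. GibbsKernelInvariant and
KreinSymmetry are infrastructure/tool items, deliberately not hypotheses.

Rationale: WHY THIS LINE. BLR's κ is read off the RELAXATION SPECTRUM of the equilibrium N-site generator L_N =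
A_H + γS on L²(μ_N): for a normal conductor the bottom of −N²L_N in the energy sector must converge
to the Dirichlet heat spectrum π²k²·κ/c_v (a Weyl law; folklore of approach-to-equilibrium MD,
LampinEtAl2013), whereas the solved harmonic member has an anomalously DENSE slow spectrum λ_S ≍ N⁻³
(BeckerMenegaki2022 Thm 1, Menegaki2020 Prop 1.6) — so anharmonicity must ACCELERATE the heat mode's
relaxation, a sharp falsifiable target replacing the impossible N-uniform gap (Villani2009 §9.2;
barriers BeckerMenegaki2022_gapClosing, equilibrium_rate_bound). Imported areas: spectral theory of
non-self-adjoint hypoelliptic generators (momentum-flip detailed balance makes L_N self-adjoint for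
the indefinite Krein form [f,g] = ⟨Θf,g⟩: HerauHitrikSjostrand2011 §3.1, low eigenvalues real of
positive type; compact resolvent at fixed N: EckmannHairer2003, CuneoEckmannHairerReyBellet2018),
the N⁻² hydrodynamic gaps and equilibrium-fluctuation limits of conservative lattice systems
(LuYau1993, Quastel1992, KipnisLandim1999; for noisy oscillator chains BernardinOlla2005,
BernardinHuveneersLebowitzLiveraniOlla2015, KomorowskiOllaSimon2021;
deterministic-with-chaotic-forcing CanestrariLiveraniOlla2026) as models, and the open-chain Kubo
formula (N−1)T²D_N = ∫₀^∞⟨J(t)J(0)⟩_N (KunduDharNarayan2009) for the identification H. What no open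
route does: FourierGreenKubo integrates the infinite-volume current autocorrelation,
CurrentTiltQuench/OddSectorIrreversibility attack the odd (current) sector, BondHeatUncertainty
bounds response by fluctuation–dissipation cost; this line makes the two halves of Fourier's law two
ONE-SIDED N⁻² bounds on ONE even equilibrium mode (positivity = L, finiteness = U) and the constant
an eigenvalue asymptotic, each checkable by equilibrium MD and small-N spectra. Versus the retired
WeylLawForHeat: L is now MODE-SPECIFIC (exactly what the deciding theorem consumes; the full L²
hydrodynamic gap is the foreseen engine, not an item), and the deciding theorem `closes … :
FouriersLaw` is PROVED (Sketch.lean rc 0, standard axioms).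

RANKED CRUXES. #2 HeatModeGap (crux) — (card crux 1, W2/L, mode-specific) for all parameters > 0 and
T > 0 there are A, r > 0 such that for every N ≥ 1 and t ≥ 0: c_N(t) ≤ A·e^(−rt/N²)·V_N — the
Dirichlet sine energy mode of the equilibrium thermostatted chain decorrelates at rate ≥ r/N² with
an N-UNIFORM prefactor; false for the harmonic member (band-edge phonons with transit times ≍ N²/k
leave a tail ≍ 1/(sN) at t = N²s, the N⁻³ sector of BeckerMenegaki2022), so it encodes
"anharmonicity sweeps the slow phonon sector away from the heat mode". [difficulty: open-problem]
(why it might fail: Needs an N-uniform prefactor: near-integrable low-T / weak-(lam,β) regimes have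
phonon mean free path ℓ(T) ≫ N over long crossovers (A, r degrade, r(T)→0), and an emergent even
quasi-conserved density overlapping E_N would add a slower component.) [BeckerMenegaki2022,
Menegaki2020, Villani2009, HairerMattingly2009, CuneoEckmannHairerReyBellet2018, LuYau1993,
Literature.Barriers.AtomisticToContinuum.equilibrium_rate_bound]
#3 SineModeDiffusive (crux) — (card crux 2, W1-upper/U) for all parameters > 0 and T > 0 there is C
such that for every N ≥ 1 and t ≥ 0: c_N(t) ≥ (1 − C·t/N²)·V_N, i.e. Var(E_N(t) − E_N(0)) ≤
2C·t·V_N/N² in the stationary process: by the continuity equation (L e_i = j_(i−1) − j_i + bath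
terms, mode gradient π/N) this is a diffusive bound on the variance of the cos-weighted
time-integrated total current, uniformly in N and t — the finiteness half of Fourier's law
(open-chain Green–Kubo integrability); it excludes the faster-than-diffusive branch of WeylLimit.
[difficulty: XL] (why it might fail: It is an N,t-uniform LINEAR bound on the energy mean-square
displacement: false for the harmonic member (ballistic, 1 − c_N/V_N ≈ a·t²/N² up to t ≍ N) and under
any odd conserved charge; C(T) ≳ 2π²κ/c_v is unbounded as T → 0.) [KunduDharNarayan2009,
BonettoLebowitzReyBellet2000, LepriLiviPoliti2003, BernardinHuveneersLebowitzLiveraniOlla2015,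
Literature.Barriers.AtomisticToContinuum.HarmonicChainBallisticFlux]
#4 WeylLimit (crux) — (card crux 3, W1 with constant, stated so that both one-sided cruxes stay
load-bearing) for all parameters > 0 and T > 0 there is D_th ≥ 0 such that EITHER for every s ≥ 0,
c_N(N²s)/V_N → exp(−π²·D_th·s) as N → ∞ (one real hydrodynamic mode asymptotically carries ALL of
the sine-mode variance: sin(πx) is the exact first Dirichlet eigenfunction of the limiting
constant-coefficient heat semigroup; contact/Robin corrections are O(1/N)), OR for every s > 0,
c_N(N²s)/V_N → 0 (relaxation faster than diffusive, the D_th = ∞ end of the family, excluded by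
SineModeDiffusive). [difficulty: open-problem] (why it might fail: The diffusive-clock limit may
fail to exist (size resonances at low T make N²λ₁ oscillate; slow crossovers), or E_N keeps O(1)
weight on a second even slow density, giving a two-exponential limit outside the family e^(−π²Ds).)
[LampinEtAl2013, BernardinOlla2005, KomorowskiOllaSimon2021, CanestrariLiveraniOlla2026, Spohn1991,
HerauHitrikSjostrand2011]
#5 EinsteinRelation (crux) — (card: HydrodynamicConsistency) for all parameters > 0 and T > 0, under
weak-NESS uniqueness, for every steady-state family μ and every sequence D of finite-N response
coefficients (D N = lim_(δ→0,δ≠0) totalCurrent(μ N (T+δ/2) (T−δ/2))/δ), and all reals D_th > 0, c_v: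
IF c_N(N²s)/V_N → exp(−π²D_th·s) for every s ≥ 0 AND Var_μN(H_N)/(N·T²) → c_v THEN D N → c_v·D_th —
the Einstein relation κ = c_v·D_th for the boundary-driven chain: open-chain Kubo formula (N−1)T²D_N
= ∫₀^∞⟨J(t)J(0)⟩_N plus the continuity equation tie D_N to the same current correlations that drive
the decay of E_N up to diffusive times. [deps: WeylLimit, SpecificHeatLimit] [difficulty:
open-problem] (why it might fail: It is a hydrodynamic-limit statement of the stmt-0742 class: needs
the open-chain Kubo formula and N-uniform control of current correlations up to times ≍ N²;
contact-dominated corners could decouple D_N from the bulk mode, and a prover may have to establish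
the conclusion outright.) [KunduDharNarayan2009, BonettoLebowitzReyBellet2000, Dhar2008,
ReyBellet2003, Spohn1991, KipnisLandim1999, BernardinOlla2005]
#9 SineModeBasics (support) — for all parameters > 0, T > 0 and N ≥ 1 the sine energy mode E_N is in
L²(μ_N) and has positive Gibbs variance V_N > 0 (polynomial moments under the Gibbs measure via the
proved e^(ϑH)-integrability; non-constancy of E_N). De-junks the Bochner integrals of L, U, W, H and
is consumed by the deciding theorem. [difficulty: provable-now] [CuneoEckmannHairerReyBellet2018,
BonettoLebowitzReyBellet2000]
#9 SpecificHeatLimit (support) — for all parameters > 0 and T > 0 the specific heat per site exists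
and is positive: Var_μN(H_N)/(N·T²) → c_v(T) > 0 (kinetic part alone gives ≥ 1/2; convergence by the
1-D transfer operator e^(−U/2T)e^(−V(q′−q)/T)e^(−U/2T), Hilbert–Schmidt with simple top eigenvalue,
analytic free energy). Standard 1-D equilibrium statistical mechanics; consumed by the deciding
theorem (κ := c_v·D_th). [difficulty: L] [Spohn1991, arXiv:2604.14056, BonettoLebowitzReyBellet2000]
#9 GibbsKernelInvariant (support) — for all parameters > 0, T > 0, N ≥ 1 and t ≥ 0 the Gibbs measure
is INVARIANT for the constructed transition kernels at equal bath temperatures: (gibbsMeasure N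
T).bind (transitionKernel N T T t) = gibbsMeasure N T (in tree only weak stationarity
pinnedChain_isSteadyState_gibbsMeasure is proved; invariance = Echeverría / EthierKurtz1986 Thm
4.9.17 or Itô on the pathwise solution). Infrastructure for contraction of K_t on L²(μ_N) and
stationarity of correlations used by every crux; not a hypothesis of the deciding theorem.
[difficulty: M] [EthierKurtz1986, CuneoEckmannHairerReyBellet2018]
#9 KreinSymmetry (support) — (card support 4, the structural lever) DETAILED BALANCE WITH MOMENTUM
FLIP for every chain with C¹ potentials, T > 0 and integrable Gibbs density: for f, g ∈ C²_c, ∫ f·(L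
g) dμ_T = ∫ g·((L(f∘Θ))∘Θ) dμ_T with L = P.generator N T T, Θ = momentumReversal — i.e. L† = ΘLΘ in
L²(μ_T), so L is formally self-adjoint for the Krein form [f,g] := ⟨Θf,g⟩ (HerauHitrikSjostrand2011
§3.1 Props 3.1–3.2): hydrodynamic eigenvalues real of positive type. Provable now from
integral_liouville/bath_mul_gibbsDensity (LangevinChainGibbs); the tool for L and W, not a
hypothesis of the deciding theorem. [difficulty: provable-now] [HerauHitrikSjostrand2011,
BonettoLebowitzReyBellet2000]
#9 NessUnique (support) — (shared item stmt-AtomisticToContinuum-0741) uniqueness of the weak steady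
state (IsSteadyState class) of pinnedChain for all N, T_L, T_R > 0; with the proved fact
pinnedChain_exists_isSteadyState it gives clause (i) and makes D_N canonical. [difficulty: L]
[CuneoEckmannHairerReyBellet2018, Carmona2007]
#9 PinnedSteadyStateExists (support) — (shared item stmt-AtomisticToContinuum-9900, added by the
2026-08-15 route-repair) clause (i) EXISTENCE: for pinnedChain ω₂ lam β γ (all > 0), every N and
T_L, T_R > 0 a weak steady state (IsSteadyState) exists — PROVED in tree as
Literature.MathematicalPhysics.KineticTheory.HeatConduction.pinnedChain_exists_isSteadyState
(LangevinChainNESSHolds.lean, CEHR2018 Thm 2.13); a one-line Theorems file closes it (evidence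
PinnedSteadyStateExistsProof.lean attached, rc 0); taken as an ITEM so that the deciding theorem
consumes it as a hypothesis and this Theses file no longer imports LangevinChainNESSHolds.
[difficulty: provable-now] [CuneoEckmannHairerReyBellet2018]
#9 FiniteResponseOfUnique (support) — (shared item stmt-AtomisticToContinuum-0717) under weak-NESS
uniqueness the finite-N linear-response limits D_N(T) exist for every steady-state family, T > 0 and
N (differentiability of NESS expectations in the bath temperatures at equilibrium). [difficulty: L]
[ReyBellet2003, HairerMajda2009]

TWO-LAYER PLAN. Foreseen glued splits (k ≤ 3, depth 1), none filed now: HeatModeGap ⇐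
FixedNModeDecay (at each N, exponential decay of c_N from the weighted-norm Harris/compact-resolvent
theory, EckmannHairer2003/CuneoEckmannHairerReyBellet2018) → HydrodynamicGap (the card's W2: an
L²(μ_N) or Krein-positive-sector gap ≳ N⁻² with N-uniform prefactor — weighted hypocoercivity with
hydrodynamic k-dependent weights, or Krein min–max on the positive-type sector starting from the
explicit Ornstein–Uhlenbeck spectrum at lam = β = 0) → HeatModeGap. SineModeDiffusive ⇐
CurrentNoiseBound (∫₀^t⟨J_cos, K_s J_cos⟩ ds ≤ C·N uniformly) → DynkinForModes (Dynkin +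
GibbsKernelInvariant for polynomial observables: Var(E_N(t) − E_N(0)) = 2(V_N − c_N(t))) →
SineModeDiffusive. EinsteinRelation ⇐ OpenChainKubo (KDN identity) → CurrentFromMode (current
correlations from the energy kernel via the continuity equation up to diffusive times) →
EinsteinRelation; the Feshbach–Schur memory-kernel decomposition of W ∧ H is the natural ALTERNATIVE
decomposition (a sibling route sharing these decls).

KILL CRITERIA. A proof that the sine energy mode of the anharmonic chain has a correlation tail
slower than e^(−rt/N²) with N-uniform prefactor (¬HeatModeGap: e.g. a positive-temperature breather
family or an even quasi-conserved density overlapping E_N) closes the route `refuted:HeatModeGap`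
and hands the witness to the negatives index (it bears on every hydrodynamic line).
¬SineModeDiffusive (super-diffusive or ballistic energy spreading at some T) refutes finiteness of κ
itself — file it as ¬FouriersLaw material. WeylLimit refuted by a two-mode / stretched limit ⇒
pivot: restate W for the spectral projection onto the slowest real (Krein positive-type) eigenvalue
instead of the sine mode. If route FourierGreenKubo closes stmt-0742 + 0703, EinsteinRelation
becomes a corollary (κ_GK = c_v·D_th) and this route is superseded for the conjunct, keeping L, U, W
as the relaxation-spectrum theorems.

NOT DECOMPOSED YET. The engine of HeatModeGap (weighted hypocoercivity vs Krein min–max vs FGR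
widths ∝ (lam·T)² of the harmonic N⁻³ modes) and the card's full W2 (no observable slower than heat)
— an L²(μ_N)-generator as an unbounded operator is not in tree, so no typed item yet; higher modes k
≥ 2 and the Robin/contact correction N → N + ℓ_L + ℓ_R; T-dependence/continuity of κ; the KDN
identity as a separate typed item (shared burden with the contact/escape cards);
GibbsKernelInvariant's FP-uniqueness lemma (shared burden with stmt-0741).

CHEAPEST FALSIFIER. (i) Small-N spectra, no dynamics: Hermite-polynomial Galerkin matrix of L_N on
L²(μ_N) for N = 2, 3, 4 at (ω₂,lam,β,γ,T) = (1,1,1,1,1): is the slowest non-zero eigenvalue in the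
Θ-even sector REAL with an energy-like eigenvector, and does N²·Re λ₁ head for a plateau while the
lam = β = 0 control follows N⁻³? A complex slowest pair or a Θ-odd slowest mode kills WeylLimit's
diffusive branch as stated. (ii) Equilibrium MD of the open chain, N ∈ {16,…,256}: fit c_N(t)/V_N on
the clock t/N²; the line dies if the curves do not collapse onto one exponential, if 1 − c_N/V_N
grows faster than linearly in t/N² (¬U), or if the collapse constant disagrees with π²κ_NEMD/c_v
(AokiKusnezov2000 / LepriLiviPoliti2003 values). Not run here (plancard unit, no kit job); protocol
recorded for the refuter.

NUMBERS. Harmonic member: λ_S ≍ N⁻³ (BeckerMenegaki2022 Thm 1 (1)); any chain at equilibrium: an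
L²(μ_N) decay estimate with prefactor C has rate ≤ 4√2·γ·ln(2C)/√N (equilibrium_rate_bound, proved)
— consistent with r/N² by 3/2 orders; trace bound λ_S ≤ γ/N (BeckerMenegaki2022_gapClosing, proved).
Expected: c_N(N²s)/V_N → e^(−π²D_th s) with D_th = κ/c_v, c_v ≥ 1/2 (kinetic) and ⟨e⟩/T ∈ [1, 3/2]
(virial); U's constant C ≈ 2π²D_th; Robin correction N → N + 2ℓ, ℓ = κ × contact resistance
(LepriLiviPoliti2003 §3.4). Items at open: 11 (4 cruxes, 6 support, 1 assembly) + the proved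
deciding theorem `closes`; after the 2026-08-15 route-repair: 12 (4 cruxes, 7 support incl.
PinnedSteadyStateExists, 1 assembly restated with nine hypotheses).

DEFINITION REQUESTS. IMPORTS (route-repair 2026-08-15, cone guardrail): the Theses file imports only
Literature.MathematicalPhysics.KineticTheory.LangevinChainKernel (transitionKernel — every crux is
about the CONSTRUCTED kernels) and LangevinChainGibbs (gibbsMeasure, gibbsDensity,
momentumReversal); LangevinChainNESS (redundant, re-exported by Gibbs) and LangevinChainNESSHolds
(needed only by the old deciding theorem's call of pinnedChain_exists_isSteadyState, now the item
PinnedSteadyStateExists) are dropped — module cone 71 → 37 project modules; the gate's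
constant-level cone (#h21_route_deps) of items + closes contains no unproved named fact. Residual
import-cone members without an `X_holds`-named witness are NOT used by any item:
Literature.Analysis.Distribution.Hormander1967_thm11 (in cone only because LangevinChainSDE imports
LangevinChainHormander for the vocabulary drift/bathWeight; PROVED in tree as
Literature.Analysis.Hypoelliptic.hormander1967_thm11_proof) and the sibling summit statements
HydrodynamicLimit / Crystallization / BoseEinsteinCondensation (imported by
Summits.AtomisticToContinuum.Statement and by FouriersLaw/Statement.lean itself — operator-side).
None needed otherwise: every statement is typed over FouriersLaw.lean + LangevinChainKernel
(transitionKernel) + LangevinChainGibbs (gibbsMeasure, gibbsDensity, momentumReversal); the sine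
mode, its variance and autocorrelation are written inline with `let`. A convenience definition
OscillatorChain.energyMode / modeAutocorrelation in Literature/MathematicalPhysics/KineticTheory
would shorten the decls; the L²(μ_N)-generator as an unbounded (Krein-self-adjoint) operator is the
one notion Lean lacks and is deliberately not requested at open.

Novelty: Searches (2026-08-15, this planner, on top of the card's and its novelty audit's): `lit search
--hybrid "spectral gap relaxation rate
anharmonic chain … N^-2"` (15 book hits, none on oscillator chains); `lit search --source zbmath
"spectral gap chain of oscillators"`
(5: Menegaki2020, BeckerMenegaki2022, Erignoux–Simon 2019 arXiv:1402.3617 — harmonic/disordered +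
noise only); `lit search --source
zbmath "velocity flip hydrodynamic limit chain oscillators"` (1: Simon 2013 arXiv:1206.2227); `lit
galaxy search "relaxation of the
slowest mode anharmonic chain" --star all` (0) and `"approach-to-equilibrium molecular dynamics"
--star all` (5: two materials
monographs, Monmarché–Spacek–Stoltz arXiv:2410.00212 on transient estimators of transport
coefficients, a phonon thesis);
`lit frontier AtomisticToContinuum --since 2023` (30 rows: CanestrariLiveraniOlla2026
arXiv:2310.13338 read pp. 1–4 — heat equation
for a harmonic chain under fast chaotic forcing, "no direct hydrodynamic result for the heat
equation … for purely deterministic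
interacting systems"; arXiv:2604.14056 specific heat of driven chains, relevant to SpecificHeatLimit
only); openalex/s2 rate-limited
(recorded, not worked around); the six open FouriersLaw routes (none uses relaxation rates of the
finite thermostatted chain).
Nearest prior art found: BeckerMenegaki2022 / Menegaki2020 (exact harmonic N⁻³ law, weakly
anharmonic lower bounds);
HerauHitrikSjostrand2011 (Krein/PT self-adjointness of Kramers–Fokker–Planck oper  [refs: 1402.3617, 1206.2227, 2410.00212, 2310.13338, 2604.14056, Menegaki2020, BeckerMenegaki2022, CanestrariLiveraniOlla2026, HerauHitrikSjostrand2011, LampinEtAl2013, BernardinOlla2005, BernardinHuveneersLebowitzLiveraniOlla2015, KomorowskiOllaSimon2021, LuYau1993]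

Barriers (technique_class: weyl-law relaxation-spectrum einstein-relation krein-sign): - technique_class: weyl-law relaxation-spectrum einstein-relation krein-sign
- Literature.Barriers.AtomisticToContinuum.BeckerMenegaki2022_gapClosing: EMBRACED — no N-uniform
rate is claimed; HeatModeGap asks for rate r/N² on one mode, outside the barrier's "N-uniform gap"
class, and the proved harmonic N⁻³ law is the contrast the route must beat (L is false at lam = β =
0, as it must be).
- Literature.Barriers.AtomisticToContinuum.equilibrium_rate_bound: consistent by 3/2 orders — with
prefactor A the barrier allows rates up to 4√2γ·ln(2A)/√N ≫ r/N²; U is the diffusive sharpening of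
the same slow-observable mechanism (rate_le_of_slowObservable) for the sine mode.
- Literature.Barriers.AtomisticToContinuum.HairerMattingly2009_threeOscillators: the named failure
mode of HeatModeGap (slow high-energy local modes); pinnedChain has interaction degree = pinning
degree (CEHR C5), where exponential convergence holds at each fixed N, but the N-uniform prefactor
over rare high-energy configurations is exactly what L bets on — it does not evade, it decides.
- Literature.Barriers.AtomisticToContinuum.HasBoundedResponse: nothing is extrapolated from fixed N
— every crux is asymptotic in N; bounded response follows from U ∧ W ∧ H, never assumed.
- Literature.Barriers.AtomisticToContinuum.HarmonicChainBallisticFlux: evaded by design — at lam = β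
= 0 both L (phonon tail) and U (ballistic spreading) FAIL while W holds in its degenerate branch;
the route cannot prove Fourier's law for the har

History (route lifecycle, newest last):
- 2026-08-15T19:25:18Z · rev 1: restated Assembly (stmt-AtomisticToContinuum-12401) — route-repair (cone guardrail, gen 1): RE-ROUTED AROUND the import cone. imports := [LangevinChainKernel, LangevinChainGibbs] — dropped LangevinChainNESS (redund (planner-rrepair-AtomisticToContinuum-HeatModeW-c17cf7e1-0)
- 2026-08-22T07:30:02Z · DORMANT — reconciler: no traction for 5.2 d (last activity item-evidence-added at 2026-08-17T02:50:44Z); parked, not closed — `ledger route dormant route-AtomisticToConti (operator:999:1970056)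

sub-problem: FouriersLaw · status: dormant · opened planner-plancard-AtomisticToContinuum-Fourier-c4518749-g2-0 2026-08-15T18:54:29Z · rev 1 · ledger route-AtomisticToContinuum-HeatModeWeylLaw
GENERATED by the gate from the ledger (D-0016/17). Provers cite these decls: `theorem foo : Summit.AtomisticToContinuum.FouriersLaw.Theses.HeatModeWeylLaw.<Decl> := …` in Summits/AtomisticToContinuum/FouriersLaw/Theorems/<Name>.lean.
-/

namespace Summit.AtomisticToContinuum.FouriersLaw.Theses.HeatModeWeylLaw

open scoped BigOperators Topology Manifold Classical MeasureTheory ProbabilityTheory Matrix InnerProductSpace ComplexConjugate ContinuousMap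
open Filter Set Function TopologicalSpace MeasureTheory

attribute [summit_statement] _root_.FouriersLaw

/-- item stmt-AtomisticToContinuum-12393 · crux · rank 2 · open · by planner
why it might fail: Needs an N-uniform prefactor: near-integrable low-T / weak-(lam,β) regimes have phonon mean free path ℓ(T) ≫ N over long crossovers (A, r degrade, r(T)→0), and an emergent even quasi-conserved density overlapping E_N would add a slower component.
sources: BeckerMenegaki2022, Menegaki2020, Villani2009, HairerMattingly2009, CuneoEckmannHairerReyBellet2018, LuYau1993
[crux] (card crux 1, W2/L, mode-specific) for all parameters > 0 and T > 0 there are A, r > 0 such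
that for every N ≥ 1 and t ≥ 0: c_N(t) ≤ A·e^(−rt/N²)·V_N — the Dirichlet sine energy mode of the
equilibrium thermostatted chain decorrelates at rate ≥ r/N² with an N-UNIFORM prefactor; false for
the harmonic member (band-edge phonons with transit times ≍ N²/k leave a tail ≍ 1/(sN) at t = N²s,
the N⁻³ sector of BeckerMenegaki2022), so it encodes "anharmonicity sweeps the slow phonon sector
away from the heat mode". [difficulty: open-problem] -/
@[route_item "route-AtomisticToContinuum-HeatModeWeylLaw", crux]
def HeatModeGap : Prop :=
  ∀ ω₂ lam β γ : ℝ, 0 < ω₂ → 0 < lam → 0 < β → 0 < γ → ∀ T : ℝ, 0 < T → (let P := Literature.MathematicalPhysics.KineticTheory.HeatConduction.pinnedChain ω₂ lam β γ; let e : (N : ℕ) → Literature.MathematicalPhysics.KineticTheory.HeatConduction.PhaseSpace N → ℝ := fun N x => (∑ i : Fin N, Real.sin (Real.pi * ((i : ℝ) + 1 / 2) / N) * (x.2 i ^ 2 / 2 + P.U (x.1 i))) + ∑ i : Fin N, ∑ j : Fin N, (if j.val = i.val + 1 then (Real.sin (Real.pi * ((i : ℝ) + 1 / 2) / N) + Real.sin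 (Real.pi * ((j : ℝ) + 1 / 2) / N)) / 2 * P.V (x.1 j - x.1 i) else 0); let V : ℕ → ℝ := fun N => ∫ x, (e N x - ∫ y, e N y ∂(P.gibbsMeasure N T)) ^ 2 ∂(P.gibbsMeasure N T); let c : ℕ → ℝ → ℝ := fun N t => ∫ x, (e N x - ∫ y, e N y ∂(P.gibbsMeasure N T)) * (∫ y, (e N y - ∫ z, e N z ∂(P.gibbsMeasure N T)) ∂(P.transitionKernel N T T t.toNNReal x)) ∂(P.gibbsMeasure N T); ∃ A r : ℝ, 0 < A ∧ 0 < r ∧ ∀ N : ℕ, 1 ≤ N → ∀ t : ℝ, 0 ≤ t → c N t ≤ A * Real.exp (-(r * t / (N : ℝ) ^ 2)) * V N)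

/-- item stmt-AtomisticToContinuum-12394 · crux · rank 3 · open · by planner
why it might fail: It is an N,t-uniform LINEAR bound on the energy mean-square displacement: false for the harmonic member (ballistic, 1 − c_N/V_N ≈ a·t²/N² up to t ≍ N) and under any odd conserved charge; C(T) ≳ 2π²κ/c_v is unbounded as T → 0.
sources: KunduDharNarayan2009, BonettoLebowitzReyBellet2000, LepriLiviPoliti2003, BernardinHuveneersLebowitzLiveraniOlla2015, Literature.Barriers.AtomisticToContinuum.HarmonicChainBallisticFlux
[crux] (card crux 2, W1-upper/U) for all parameters > 0 and T > 0 there is C such that for every N ≥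
1 and t ≥ 0: c_N(t) ≥ (1 − C·t/N²)·V_N, i.e. Var(E_N(t) − E_N(0)) ≤ 2C·t·V_N/N² in the stationary
process: by the continuity equation (L e_i = j_(i−1) − j_i + bath terms, mode gradient π/N) this is
a diffusive bound on the variance of the cos-weighted time-integrated total current, uniformly in N
and t — the finiteness half of Fourier's law (open-chain Green–Kubo integrability); it excludes the
faster-than-diffusive branch of WeylLimit. [difficulty: XL] -/
@[route_item "route-AtomisticToContinuum-HeatModeWeylLaw", crux]
def SineModeDiffusive : Prop :=
  ∀ ω₂ lam β γ : ℝ, 0 < ω₂ → 0 < lam → 0 < β → 0 < γ → ∀ T : ℝ, 0 < T → (let P := Literature.MathematicalPhysics.KineticTheory.HeatConduction.pinnedChain ω₂ lam β γ; let e : (N : ℕ) → Literature.MathematicalPhysics.KineticTheory.HeatConduction.PhaseSpace N → ℝ := fun N x => (∑ i : Fin N, Real.sin (Real.pi * ((i : ℝ) + 1 / 2) / N) * (x.2 i ^ 2 / 2 + P.U (x.1 i))) + ∑ i : Fin N, ∑ j : Fin N, (if j.val = i.val + 1 then (Real.sin (Real.pi * ((i : ℝ) + 1 / 2) / N) + Real.sin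 (Real.pi * ((j : ℝ) + 1 / 2) / N)) / 2 * P.V (x.1 j - x.1 i) else 0); let V : ℕ → ℝ := fun N => ∫ x, (e N x - ∫ y, e N y ∂(P.gibbsMeasure N T)) ^ 2 ∂(P.gibbsMeasure N T); let c : ℕ → ℝ → ℝ := fun N t => ∫ x, (e N x - ∫ y, e N y ∂(P.gibbsMeasure N T)) * (∫ y, (e N y - ∫ z, e N z ∂(P.gibbsMeasure N T)) ∂(P.transitionKernel N T T t.toNNReal x)) ∂(P.gibbsMeasure N T); ∃ C : ℝ, ∀ N : ℕ, 1 ≤ N → ∀ t : ℝ, 0 ≤ t → (1 - C * t / (N : ℝ) ^ 2) * V N ≤ c N t)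

/-- item stmt-AtomisticToContinuum-12395 · crux · rank 4 · open · by planner
why it might fail: The diffusive-clock limit may fail to exist (size resonances at low T make N²λ₁ oscillate; slow crossovers), or E_N keeps O(1) weight on a second even slow density, giving a two-exponential limit outside the family e^(−π²Ds).
sources: LampinEtAl2013, BernardinOlla2005, KomorowskiOllaSimon2021, CanestrariLiveraniOlla2026, Spohn1991, HerauHitrikSjostrand2011
[crux] (card crux 3, W1 with constant, stated so that both one-sided cruxes stay load-bearing) for
all parameters > 0 and T > 0 there is D_th ≥ 0 such that EITHER for every s ≥ 0, c_N(N²s)/V_N →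
exp(−π²·D_th·s) as N → ∞ (one real hydrodynamic mode asymptotically carries ALL of the sine-mode
variance: sin(πx) is the exact first Dirichlet eigenfunction of the limiting constant-coefficient
heat semigroup; contact/Robin corrections are O(1/N)), OR for every s > 0, c_N(N²s)/V_N → 0
(relaxation faster than diffusive, the D_th = ∞ end of the family, excluded by SineModeDiffusive).
[difficulty: open-problem] -/
@[route_item "route-AtomisticToContinuum-HeatModeWeylLaw", crux]
def WeylLimit : Prop :=
  ∀ ω₂ lam β γ : ℝ, 0 < ω₂ → 0 < lam → 0 < β → 0 < γ → ∀ T : ℝ, 0 < T → (let P := Literature.MathematicalPhysics.KineticTheory.HeatConduction.pinnedChain ω₂ lam β γ; let e : (N : ℕ) → Literature.MathematicalPhysics.KineticTheory.HeatConduction.PhaseSpace N → ℝ := fun N x => (∑ i : Fin N, Real.sin (Real.pi * ((i : ℝ) + 1 / 2) / N) * (x.2 i ^ 2 / 2 + P.U (x.1 i))) + ∑ i : Fin N, ∑ j : Fin N, (if j.val = i.val + 1 then (Real.sin (Real.pi * ((i : ℝ) + 1 / 2) / N) + Real.sin (Real.pi * ((j : ℝ) + 1 / 2) / N)) / 2 *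 P.V (x.1 j - x.1 i) else 0); let V : ℕ → ℝ := fun N => ∫ x, (e N x - ∫ y, e N y ∂(P.gibbsMeasure N T)) ^ 2 ∂(P.gibbsMeasure N T); let c : ℕ → ℝ → ℝ := fun N t => ∫ x, (e N x - ∫ y, e N y ∂(P.gibbsMeasure N T)) * (∫ y, (e N y - ∫ z, e N z ∂(P.gibbsMeasure N T)) ∂(P.transitionKernel N T T t.toNNReal x)) ∂(P.gibbsMeasure N T); ∃ Dth : ℝ, 0 ≤ Dth ∧ ((∀ s : ℝ, 0 ≤ s → Filter.Tendsto (fun N : ℕ => c N ((N : ℝ) ^ 2 * s) / V N) Filter.atTop (nhds (Real.exp (-(Real.pi ^ 2 * Dth * s))))) ∨ (∀ s : ℝ, 0 < s → Filter.Tendsto (fun N : ℕ => c N ((N : ℝ) ^ 2 * s) / V N) Filter.atTop (nhds 0))))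

/-- item stmt-AtomisticToContinuum-12396 · crux · rank 5 · open · by planner
why it might fail: It is a hydrodynamic-limit statement of the stmt-0742 class: needs the open-chain Kubo formula and N-uniform control of current correlations up to times ≍ N²; contact-dominated corners could decouple D_N from the bulk mode, and a prover may have to establish the conclusion outright.
sources: KunduDharNarayan2009, BonettoLebowitzReyBellet2000, Dhar2008, ReyBellet2003, Spohn1991, KipnisLandim1999
[crux] (card: HydrodynamicConsistency) for all parameters > 0 and T > 0, under weak-NESS uniqueness,
for every steady-state family μ and every sequence D of finite-N response coefficients (D N =
lim_(δ→0,δ≠0) totalCurrent(μ N (T+δ/2) (T−δ/2))/δ), and all reals D_th > 0, c_v: IF c_N(N²s)/V_N →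
exp(−π²D_th·s) for every s ≥ 0 AND Var_μN(H_N)/(N·T²) → c_v THEN D N → c_v·D_th — the Einstein
relation κ = c_v·D_th for the boundary-driven chain: open-chain Kubo formula (N−1)T²D_N =
∫₀^∞⟨J(t)J(0)⟩_N plus the continuity equation tie D_N to the same current correlations that drive
the decay of E_N up to diffusive times. [deps: WeylLimit, SpecificHeatLimit] [difficulty:
open-problem] -/
@[route_item "route-AtomisticToContinuum-HeatModeWeylLaw", crux]
def EinsteinRelation : Prop :=
  ∀ ω₂ lam β γ : ℝ, 0 < ω₂ → 0 < lam → 0 < β → 0 < γ → ∀ T : ℝ, 0 < T → (let P := Literature.MathematicalPhysics.KineticTheory.HeatConduction.pinnedChain ω₂ lam β γ; let e : (N : ℕ) → Literature.MathematicalPhysics.KineticTheory.HeatConduction.PhaseSpace N → ℝ := fun N x => (∑ i : Fin N, Real.sin (Real.pi * ((i : ℝ) + 1 / 2) / N) * (x.2 i ^ 2 / 2 + P.U (x.1 i))) + ∑ i : Fin N, ∑ j : Fin N, (if j.val = i.val + 1 then (Real.sin (Real.pi * ((i : ℝ) + 1 / 2) / N) + Real.sin (Real.pi * ((j : ℝ)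 + 1 / 2) / N)) / 2 * P.V (x.1 j - x.1 i) else 0); let V : ℕ → ℝ := fun N => ∫ x, (e N x - ∫ y, e N y ∂(P.gibbsMeasure N T)) ^ 2 ∂(P.gibbsMeasure N T); let c : ℕ → ℝ → ℝ := fun N t => ∫ x, (e N x - ∫ y, e N y ∂(P.gibbsMeasure N T)) * (∫ y, (e N y - ∫ z, e N z ∂(P.gibbsMeasure N T)) ∂(P.transitionKernel N T T t.toNNReal x)) ∂(P.gibbsMeasure N T); (∀ (N : ℕ) (T_L T_R : ℝ), 0 < T_L → 0 < T_R → ∀ μ ν : MeasureTheory.Measure (Literature.MathematicalPhysics.KineticTheory.HeatConduction.PhaseSpace N), P.IsSteadyState N T_L T_R μ → P.IsSteadyState N T_L T_R ν → μ = ν) → ∀ μ : (N : ℕ) → ℝ → ℝ → MeasureTheory.Measure (Literature.MathematicalPhysics.KineticTheory.HeatConduction.PhaseSpace N), (∀ (N : ℕ) (T_L T_R : ℝ), 0 < T_L → 0 < T_R → P.IsSteadyState N T_L T_R (μ N T_L T_R)) → ∀ D : ℕ → ℝ, (∀ N : ℕ, Filter.Tendsto (fun δ : ℝ => P.totalCurrent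 (μ N (T + δ / 2) (T - δ / 2)) / δ) (nhdsWithin 0 {(0 : ℝ)}ᶜ) (nhds (D N))) → ∀ Dth cv : ℝ, 0 < Dth → (∀ s : ℝ, 0 ≤ s → Filter.Tendsto (fun N : ℕ => c N ((N : ℝ) ^ 2 * s) / V N) Filter.atTop (nhds (Real.exp (-(Real.pi ^ 2 * Dth * s))))) → Filter.Tendsto (fun N : ℕ => (∫ x, (P.hamiltonian N x - ∫ y, P.hamiltonian N y ∂(P.gibbsMeasure N T)) ^ 2 ∂(P.gibbsMeasure N T)) / ((N : ℝ) * T ^ 2)) Filter.atTop (nhds cv) → Filter.Tendsto D Filter.atTop (nhds (cv * Dth)))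

/-- item stmt-AtomisticToContinuum-0717 · support · rank 9 · closed · proved by Summit.AtomisticToContinuum.FouriersLaw.Theorems.FourierGreenKubo.finiteResponseOfUnique_holds (prover) · by planner
sources: ReyBellet2003, HairerMajda2009
CONDITIONAL FORM OF 0705 (supersedes it as the prover target; refuters pool-5/g3-0: 0705 stand-alone
quantifies over EVERY steady-state family and is false-prone if weak steady states were non-unique):
assuming UNIQUENESS of weak steady states (IsSteadyState class) for pinnedChain at all N, T_L, T_R >
0, the finite-N linear-response limit D_N(T) = lim_{δ→0, δ≠0} totalCurrent(μ_{N,T+δ/2,T−δ/2})/δ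
exists for every T > 0 and N. Content: differentiability at equilibrium of NESS expectations of the
polynomial currents in the bath temperatures (ReyBellet2003 arXiv:math-ph/0303021 Rem 4.4 (51)–(56)
finite-volume Green–Kubo; HairerMajda2009 arXiv:0909.4313 Thm 2.3 framework — their SDE Thm 4.4
Assumption 5 fails here, so verify Assumptions 1–3 via CEHR2018 (2.5)/Carmona2007 Thm 1.1(iv)
weighted spectral gap). N = 0, 1: totalCurrent ≡ 0, D = 0. Together with 0706 gives 0705. -/
@[route_item "route-AtomisticToContinuum-HeatModeWeylLaw", crux]
def FiniteResponseOfUnique : Prop :=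
  ∀ ω₂ lam β γ : ℝ, 0 < ω₂ → 0 < lam → 0 < β → 0 < γ → (∀ (N : ℕ) (T_L T_R : ℝ), 0 < T_L → 0 < T_R → ∀ μ ν : MeasureTheory.Measure (Literature.MathematicalPhysics.KineticTheory.HeatConduction.PhaseSpace N), (Literature.MathematicalPhysics.KineticTheory.HeatConduction.pinnedChain ω₂ lam β γ).IsSteadyState N T_L T_R μ → (Literature.MathematicalPhysics.KineticTheory.HeatConduction.pinnedChain ω₂ lam β γ).IsSteadyState N T_L T_R ν → μ = ν) → ∀ μ : (N : ℕ) → ℝ → ℝ → MeasureTheory.Measure (Literature.MathematicalPhysics.KineticTheory.HeatConduction.PhaseSpace N), (∀ (N : ℕ) (T_L T_R : ℝ), 0 < T_L → 0 < T_R → (Literature.MathematicalPhysics.KineticTheory.HeatConduction.pinnedChain ω₂ lam β γ).IsSteadyState N T_L T_R (μ N T_L T_R)) → ∀ T : ℝ, 0 < T → ∀ N : ℕ, ∃ D : ℝ, Filter.Tendsto (fun δ : ℝ => (Literature.MathematicalPhysics.KineticTheory.HeatConduction.pinnedChain ω₂ lam β γ).totalCurrent (μ N (T + δ / 2) (T -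 δ / 2)) / δ) (nhdsWithin 0 {(0 : ℝ)}ᶜ) (nhds D)

/-- `FiniteResponseOfUnique` holds: proved by `Summit.AtomisticToContinuum.FouriersLaw.Theorems.FourierGreenKubo.finiteResponseOfUnique_holds`. -/
theorem FiniteResponseOfUnique_holds : FiniteResponseOfUnique := _root_.Summit.AtomisticToContinuum.FouriersLaw.Theorems.FourierGreenKubo.finiteResponseOfUnique_holds

/-- item stmt-AtomisticToContinuum-0741 · support · rank 9 · closed · proved by Summit.AtomisticToContinuum.FouriersLaw.Theorems.nessUnique_proof (prover) · by planner
sources: CuneoEckmannHairerReyBellet2018, Carmona2007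
[crux] UNIQUENESS OF THE WEAK STEADY STATE (the half of stmt-0706 not covered by the landed fact
Literature.MathematicalPhysics.KineticTheory.HeatConduction.CuneoEckmannHairerReyBellet2018_pinnedChain,
p3544): for pinnedChain ω₂ lam β γ (all > 0), every N and T_L, T_R > 0, any two measures in the weak
Fokker–Planck class IsSteadyState (probability, ∫ L f dμ = 0 for f ∈ C_c^∞, bond currents
integrable) coincide. Print: uniqueness of the INVARIANT MEASURE of the Langevin semigroup
(CuneoEckmannHairerReyBellet2018 Thm 2.13(1): C1, C2, CA; Carmona2007 Thm 1.1(iii)); the item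
additionally needs 'weak stationary probability solution of L*μ = 0 ⇒ P_t-invariant' for this
hypoelliptic L with cubic drift (Echeverría 1982 well-posed martingale problem on C_c^∞ +
non-explosion via e^{θH}; Bogachev–Krylov–Röckner–Shaposhnikov 2015 Ch. 5 is non-degenerate only) —
the FP-identification lemma is the formal crux. N = 0: PhaseSpace 0 is a point (unique probability
measure); N = 1: both baths on site 0, OU at temperature (T_L+T_R)/2. This is exactly the hypothesis
of FiniteResponse and ThermodynamicLimit and, with the fact, gives clause (i) of FouriersLawFor. -/
@[route_item "route-AtomisticToContinuum-HeatModeWeylLaw", crux]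
def NessUnique : Prop :=
  ∀ ω₂ lam β γ : ℝ, 0 < ω₂ → 0 < lam → 0 < β → 0 < γ → ∀ (N : ℕ) (T_L T_R : ℝ), 0 < T_L → 0 < T_R → ∀ μ ν : MeasureTheory.Measure (Literature.MathematicalPhysics.KineticTheory.HeatConduction.PhaseSpace N), (Literature.MathematicalPhysics.KineticTheory.HeatConduction.pinnedChain ω₂ lam β γ).IsSteadyState N T_L T_R μ → (Literature.MathematicalPhysics.KineticTheory.HeatConduction.pinnedChain ω₂ lam β γ).IsSteadyState N T_L T_R ν → μ = ν

/-- `NessUnique` holds: proved by `Summit.AtomisticToContinuum.FouriersLaw.Theorems.nessUnique_proof`. -/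
theorem NessUnique_holds : NessUnique := _root_.Summit.AtomisticToContinuum.FouriersLaw.Theorems.nessUnique_proof

/-- item stmt-AtomisticToContinuum-12397 · support · rank 9 · closed · proved by Summit.AtomisticToContinuum.FouriersLaw.Theorems.sineModeBasics_proof (prover) · by planner
sources: CuneoEckmannHairerReyBellet2018, BonettoLebowitzReyBellet2000
[support] for all parameters > 0, T > 0 and N ≥ 1 the sine energy mode E_N is in L²(μ_N) and has
positive Gibbs variance V_N > 0 (polynomial moments under the Gibbs measure via the proved
e^(ϑH)-integrability; non-constancy of E_N). De-junks the Bochner integrals of L, U, W, H and is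
consumed by the deciding theorem. [difficulty: provable-now] -/
@[route_item "route-AtomisticToContinuum-HeatModeWeylLaw", crux]
def SineModeBasics : Prop :=
  ∀ ω₂ lam β γ : ℝ, 0 < ω₂ → 0 < lam → 0 < β → 0 < γ → ∀ T : ℝ, 0 < T → (let P := Literature.MathematicalPhysics.KineticTheory.HeatConduction.pinnedChain ω₂ lam β γ; let e : (N : ℕ) → Literature.MathematicalPhysics.KineticTheory.HeatConduction.PhaseSpace N → ℝ := fun N x => (∑ i : Fin N, Real.sin (Real.pi * ((i : ℝ) + 1 / 2) / N) * (x.2 i ^ 2 / 2 + P.U (x.1 i))) + ∑ i : Fin N, ∑ j : Fin N, (if j.val = i.val + 1 then (Real.sin (Real.pi * ((i : ℝ) + 1 / 2) / N) + Real.sin (Real.pi * ((j : ℝ) + 1 / 2) / N)) / 2 * P.V (x.1 j - x.1 i) else 0); let V : ℕ → ℝ := fun N => ∫ x, (e N x - ∫ y, e N y ∂(P.gibbsMeasure N T)) ^ 2 ∂(P.gibbsMeasure N T); ∀ N : ℕ, 1 ≤ N → MeasureTheory.MemLp (e N) 2 (P.gibbsMeasure N T) ∧ 0 < V N)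

/-- item stmt-AtomisticToContinuum-12398 · support · rank 9 · closed · proved by Summit.AtomisticToContinuum.FouriersLaw.Theorems.specificHeatLimit_proof @ 74ba6d88cbe1 (prover) · by planner
sources: Spohn1991, arXiv:2604.14056, BonettoLebowitzReyBellet2000
[support] for all parameters > 0 and T > 0 the specific heat per site exists and is positive:
Var_μN(H_N)/(N·T²) → c_v(T) > 0 (kinetic part alone gives ≥ 1/2; convergence by the 1-D transfer
operator e^(−U/2T)e^(−V(q′−q)/T)e^(−U/2T), Hilbert–Schmidt with simple top eigenvalue, analytic free
energy). Standard 1-D equilibrium statistical mechanics; consumed by the deciding theorem (κ :=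
c_v·D_th). [difficulty: L] -/
@[route_item "route-AtomisticToContinuum-HeatModeWeylLaw", crux]
def SpecificHeatLimit : Prop :=
  ∀ ω₂ lam β γ : ℝ, 0 < ω₂ → 0 < lam → 0 < β → 0 < γ → ∀ T : ℝ, 0 < T → (let P := Literature.MathematicalPhysics.KineticTheory.HeatConduction.pinnedChain ω₂ lam β γ; ∃ cv : ℝ, 0 < cv ∧ Filter.Tendsto (fun N : ℕ => (∫ x, (P.hamiltonian N x - ∫ y, P.hamiltonian N y ∂(P.gibbsMeasure N T)) ^ 2 ∂(P.gibbsMeasure N T)) / ((N : ℝ) * T ^ 2)) Filter.atTop (nhds cv))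

/-- item stmt-AtomisticToContinuum-12399 · support · rank 9 · closed · proved by Summit.AtomisticToContinuum.FouriersLaw.Theorems.gibbsKernelInvariant_proof @ 386345bbd553 (prover) · by planner
sources: EthierKurtz1986, CuneoEckmannHairerReyBellet2018
[support] for all parameters > 0, T > 0, N ≥ 1 and t ≥ 0 the Gibbs measure is INVARIANT for the
constructed transition kernels at equal bath temperatures: (gibbsMeasure N T).bind (transitionKernel
N T T t) = gibbsMeasure N T (in tree only weak stationarity pinnedChain_isSteadyState_gibbsMeasure
is proved; invariance = Echeverría / EthierKurtz1986 Thm 4.9.17 or Itô on the pathwise solution).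
Infrastructure for contraction of K_t on L²(μ_N) and stationarity of correlations used by every
crux; not a hypothesis of the deciding theorem. [difficulty: M] -/
@[route_item "route-AtomisticToContinuum-HeatModeWeylLaw"]
def GibbsKernelInvariant : Prop :=
  ∀ ω₂ lam β γ : ℝ, 0 < ω₂ → 0 < lam → 0 < β → 0 < γ → ∀ T : ℝ, 0 < T → ∀ N : ℕ, 1 ≤ N → ∀ t : NNReal, ((Literature.MathematicalPhysics.KineticTheory.HeatConduction.pinnedChain ω₂ lam β γ).gibbsMeasure N T).bind ((Literature.MathematicalPhysics.KineticTheory.HeatConduction.pinnedChain ω₂ lam β γ).transitionKernel N T T t) = (Literature.MathematicalPhysics.KineticTheory.HeatConduction.pinnedChain ω₂ lam β γ).gibbsMeasure N T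

/-- item stmt-AtomisticToContinuum-12400 · support · rank 9 · closed · proved by Summit.AtomisticToContinuum.FouriersLaw.Theorems.kreinSymmetry_proof (prover) · by planner
sources: HerauHitrikSjostrand2011, BonettoLebowitzReyBellet2000
[support] (card support 4, the structural lever) DETAILED BALANCE WITH MOMENTUM FLIP for every chain
with C¹ potentials, T > 0 and integrable Gibbs density: for f, g ∈ C²_c, ∫ f·(L g) dμ_T = ∫
g·((L(f∘Θ))∘Θ) dμ_T with L = P.generator N T T, Θ = momentumReversal — i.e. L† = ΘLΘ in L²(μ_T), so
L is formally self-adjoint for the Krein form [f,g] := ⟨Θf,g⟩ (HerauHitrikSjostrand2011 §3.1 Props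
3.1–3.2): hydrodynamic eigenvalues real of positive type. Provable now from
integral_liouville/bath_mul_gibbsDensity (LangevinChainGibbs); the tool for L and W, not a
hypothesis of the deciding theorem. [difficulty: provable-now] -/
@[route_item "route-AtomisticToContinuum-HeatModeWeylLaw"]
def KreinSymmetry : Prop :=
  ∀ (P : Literature.MathematicalPhysics.KineticTheory.HeatConduction.OscillatorChain), ContDiff ℝ 1 P.U → ContDiff ℝ 1 P.V → ∀ (N : ℕ) (T : ℝ), 0 < T → MeasureTheory.Integrable (P.gibbsDensity N T) → ∀ f g : Literature.MathematicalPhysics.KineticTheory.HeatConduction.PhaseSpace N → ℝ, ContDiff ℝ 2 f → HasCompactSupport f → ContDiff ℝ 2 g → HasCompactSupport g → ∫ x, f x * P.generator N T T g x ∂(P.gibbsMeasure N T) = ∫ x, g x * P.generator N T T (fun y => f (Literature.MathematicalPhysics.KineticTheory.HeatConduction.momentumReversal N y)) (Literature.MathematicalPhysics.KineticTheory.HeatConduction.momentumReversal N x) ∂(P.gibbsMeasure N T)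

/-- item stmt-AtomisticToContinuum-9900 · support · rank 9 · closed · proved by Summit.AtomisticToContinuum.FouriersLaw.Theorems.pinnedSteadyStateExists_proof @ 93199528ccef (prover) · by planner
[support] CLAUSE (i) EXISTENCE FOR THE CONJUNCT'S CHAIN (route-repair 2026-08-15, cone bookkeeping;
provable now; kind support, rank 9): for pinnedChain ω₂ lam β γ with ω₂, lam, β, γ > 0, every N and
all T_L, T_R > 0 there is a weak (Fokker–Planck) steady state (OscillatorChain.IsSteadyState).
PROVED in tree:
Literature.MathematicalPhysics.KineticTheory.HeatConduction.pinnedChain_exists_isSteadyState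
(LangevinChainNESSHolds.lean; the discharged fact CuneoEckmannHairerReyBellet2018_pinnedChain for N
≥ 1 + OscillatorChain.isSteadyState_zero for N = 0) — a Theorems file importing the route file +
LangevinChainNESSHolds closes it in one line (evidence file attached:
PinnedSteadyStateExistsProof.lean, rc 0, axioms propext/Classical.choice/Quot.sound). WHY AN ITEM:
it lets the deciding theorem 'closes' take clause (i) existence as a hypothesis, so that the Theses
file can drop the import Literature.MathematicalPhysics.KineticTheory.LangevinChainNESSHolds
(≈55-module Langevin-SDE cone with the two undischarged Kolmogorov–Chentsov Hölder facts) — the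
pending route-repair edit (imports := [InfiniteChainDynamics], closes re-proved, Assembly restated;
package attached as evidence to the route -/
@[route_item "route-AtomisticToContinuum-HeatModeWeylLaw", crux]
def PinnedSteadyStateExists : Prop :=
  ∀ ω₂ lam β γ : ℝ, 0 < ω₂ → 0 < lam → 0 < β → 0 < γ → ∀ (N : ℕ) (T_L T_R : ℝ), 0 < T_L → 0 < T_R → ∃ μ : MeasureTheory.Measure (Literature.MathematicalPhysics.KineticTheory.HeatConduction.PhaseSpace N), (Literature.MathematicalPhysics.KineticTheory.HeatConduction.pinnedChain ω₂ lam β γ).IsSteadyState N T_L T_R μ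

/-- `PinnedSteadyStateExists` holds: proved by `Summit.AtomisticToContinuum.FouriersLaw.Theorems.pinnedSteadyStateExists_proof` @ 93199528ccef. -/
theorem PinnedSteadyStateExists_holds : PinnedSteadyStateExists := _root_.Summit.AtomisticToContinuum.FouriersLaw.Theorems.pinnedSteadyStateExists_proof

-- earlier Assembly (stmt-AtomisticToContinuum-12401, replaced 2026-08-15T19:25:18Z -> stmt-AtomisticToContinuum-13587): retired by None — HeatModeGap → SineModeDiffusive → WeylLimit → EinsteinRelation → SineModeBasics → SpecificHeatLimit → NessUnique → FiniteResponseOfUnique → FouriersLaw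
/-- item stmt-AtomisticToContinuum-13587 · assembly · rank 1 · closed · proved by Summit.AtomisticToContinuum.FouriersLaw.Theorems.heatModeWeylLaw_assembly_proof (prover) · by planner
sources: BonettoLebowitzReyBellet2000, CuneoEckmannHairerReyBellet2018, KunduDharNarayan2009
[assembly] HeatModeGap → SineModeDiffusive → WeylLimit → EinsteinRelation → SineModeBasics →
SpecificHeatLimit → NessUnique → PinnedSteadyStateExists → FiniteResponseOfUnique → FouriersLaw (the
sub-problem Statement decl, by name); PROVED as `theorem closes` (route-repair 2026-08-15: ninth
hypothesis PinnedSteadyStateExists = clause (i) existence, replacing the direct Literature call). -/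
@[route_item "route-AtomisticToContinuum-HeatModeWeylLaw"]
def Assembly : Prop :=
  HeatModeGap → SineModeDiffusive → WeylLimit → EinsteinRelation → SineModeBasics → SpecificHeatLimit → NessUnique → PinnedSteadyStateExists → FiniteResponseOfUnique → FouriersLaw

/-! D-0027 §2.1 — DECIDING THEOREM (planner-authored via `route open/edit --closes-file`; by planner-rrepair-AtomisticToContinuum-HeatModeW-c17cf7e1-0 2026-08-15T19:25:18Z):
its hypotheses are this route's items and its conclusion the sub-problem Statement (glue_lint), and it elaborates with this file. -/

/-- D-0027 §2.1 DECIDING THEOREM of route HeatModeWeylLaw (card weyl-law-for-heat; route-repair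
2026-08-15 rev: clause (i) existence is now the shared support item `PinnedSteadyStateExists`
(stmt-AtomisticToContinuum-9900, provable now from `pinnedChain_exists_isSteadyState`) so that this
Theses file no longer imports `LangevinChainNESSHolds`). The four cruxes L = `HeatModeGap`,
U = `SineModeDiffusive`, W = `WeylLimit`, H = `EinsteinRelation`, the two equilibrium supports
`SineModeBasics`, `SpecificHeatLimit` and the shared finite-`N` items `NessUnique` (stmt-0741),
`PinnedSteadyStateExists` (stmt-9900), `FiniteResponseOfUnique` (stmt-0717) decide the sub-problem
Statement `FouriersLaw`. Proof: clause (i) from existence + uniqueness; clause (ii) at `T > 0`: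
W gives `D_th ≥ 0` and a branch; the faster-than-diffusive branch contradicts U + `SineModeBasics`
at `s₀ = 1/(2(|C|+1))`; in the diffusive branch L gives `exp(-π² D_th s) ≤ A e^{-r s}` for all
`s ≥ 0`, hence `D_th > 0`; set `κ(T) := c_v · D_th` (`c_v > 0` from `SpecificHeatLimit`), take
`D_N` from `FiniteResponseOfUnique` and conclude `D_N → κ(T)` by H; glue the values over `T` by
choice. Standard axioms only. -/
@[closes "route-AtomisticToContinuum-HeatModeWeylLaw"] theorem closes : HeatModeGap → SineModeDiffusive → WeylLimit → EinsteinRelation → SineModeBasics →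
    SpecificHeatLimit → NessUnique → PinnedSteadyStateExists → FiniteResponseOfUnique → FouriersLaw := by
  intro hL hU hW hH hB hCv hUq hEx hR
  show ∀ ω₂ lam β γ : ℝ, 0 < ω₂ → 0 < lam → 0 < β → 0 < γ →
    (Literature.MathematicalPhysics.KineticTheory.HeatConduction.pinnedChain ω₂ lam β γ).FouriersLawFor
  intro ω₂ lam β γ hω hl hβ hγ
  have huniq := hUq ω₂ lam β γ hω hl hβ hγ
  refine ⟨fun N T_L T_R hTL hTR => ?_, ?_⟩
  · obtain ⟨μ, hμ⟩ := hEx ω₂ lam β γ hω hl hβ hγ N T_L T_R hTL hTR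
    exact ⟨μ, hμ, fun ν hν => huniq N T_L T_R hTL hTR ν μ hν hμ⟩
  -- clause (ii): at every `T > 0` a positive conductivity VALUE, then glue by choice
  have key : ∀ T : ℝ, 0 < T → ∃ k : ℝ, 0 < k ∧
      ∀ μ : (N : ℕ) → ℝ → ℝ →
          MeasureTheory.Measure (Literature.MathematicalPhysics.KineticTheory.HeatConduction.PhaseSpace N),
        (∀ (N : ℕ) (T_L T_R : ℝ), 0 < T_L → 0 < T_R →
          (Literature.MathematicalPhysics.KineticTheory.HeatConduction.pinnedChain ω₂ lam β γ).IsSteadyState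
            N T_L T_R (μ N T_L T_R)) →
        ∃ D : ℕ → ℝ,
          (∀ N : ℕ, Filter.Tendsto (fun δ : ℝ =>
            (Literature.MathematicalPhysics.KineticTheory.HeatConduction.pinnedChain ω₂ lam β γ).totalCurrent
              (μ N (T + δ / 2) (T - δ / 2)) / δ) (nhdsWithin 0 {(0 : ℝ)}ᶜ) (nhds (D N))) ∧
          Filter.Tendsto D Filter.atTop (nhds k) := by
    intro T hT
    obtain ⟨cv, hcv, hcvlim⟩ := hCv ω₂ lam β γ hω hl hβ hγ T hT
    obtain ⟨A, r, hA, hr, hgap⟩ := hL ω₂ lam β γ hω hl hβ hγ T hT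
    obtain ⟨C, hdiff⟩ := hU ω₂ lam β γ hω hl hβ hγ T hT
    have hbas := hB ω₂ lam β γ hω hl hβ hγ T hT
    obtain ⟨Dth, hD0, hbranch⟩ := hW ω₂ lam β γ hω hl hβ hγ T hT
    -- Step 1 (U excludes the faster-than-diffusive branch).
    have hE := hbranch.resolve_right (by
      intro hZ
      obtain ⟨s₀, hs₀pos, hCs⟩ : ∃ s₀ : ℝ, 0 < s₀ ∧ C * s₀ ≤ 1 / 2 := by
        refine ⟨1 / (2 * (|C| + 1)), by positivity, ?_⟩
        rw [mul_one_div, div_le_iff₀ (by positivity : (0 : ℝ) < 2 * (|C| + 1))]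
        nlinarith [le_abs_self C, abs_nonneg C]
      have hev := (hZ s₀ hs₀pos).eventually (gt_mem_nhds (show (0 : ℝ) < 1 / 2 by norm_num))
      obtain ⟨N, hNlt, hN1⟩ := (hev.and (Filter.eventually_ge_atTop 1)).exists
      have hV := (hbas N hN1).2
      have hNpos : (0 : ℝ) < N := Nat.cast_pos.mpr hN1
      have h1 := hdiff N hN1 ((N : ℝ) ^ 2 * s₀) (by positivity)
      have hCs' : C * ((N : ℝ) ^ 2 * s₀) / (N : ℝ) ^ 2 = C * s₀ := by
        field_simp
      rw [hCs'] at h1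
      have h2 := (div_lt_iff₀ hV).mp hNlt
      nlinarith [mul_nonneg (sub_nonneg.mpr hCs) hV.le, h1, h2])
    -- Step 2 (L forces a positive Weyl constant).
    have key1 : ∀ s : ℝ, 0 ≤ s → Real.exp (-(Real.pi ^ 2 * Dth * s)) ≤ A * Real.exp (-(r * s)) := by
      intro s hs
      refine le_of_tendsto (hE s hs) ?_
      filter_upwards [Filter.eventually_ge_atTop 1] with N hN
      have hV := (hbas N hN).2
      have hNpos : (0 : ℝ) < N := Nat.cast_pos.mpr hN
      have h1 := hgap N hN ((N : ℝ) ^ 2 * s) (by positivity)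
      have hrs : r * ((N : ℝ) ^ 2 * s) / (N : ℝ) ^ 2 = r * s := by
        field_simp
      rw [hrs] at h1
      rw [div_le_iff₀ hV]
      exact h1
    have hDpos : 0 < Dth := by
      by_contra hneg
      have hD : Dth = 0 := le_antisymm (not_lt.mp hneg) hD0
      have hlim : Filter.Tendsto (fun s : ℝ => A * Real.exp (-(r * s))) Filter.atTop (nhds 0) := by
        have h := (Real.tendsto_exp_neg_atTop_nhds_zero.comp
          (Filter.tendsto_id.const_mul_atTop hr)).const_mul A
        simpa using h
      have hev := hlim.eventually (gt_mem_nhds (show (0 : ℝ) < 1 by norm_num))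
      obtain ⟨s, hs1, hs0⟩ := (hev.and (Filter.eventually_ge_atTop 0)).exists
      have hs1' : A * Real.exp (-(r * s)) < 1 := hs1
      have h2 := key1 s hs0
      rw [hD] at h2
      simp only [mul_zero, zero_mul, neg_zero, Real.exp_zero] at h2
      linarith
    -- Step 3 (H identifies the conductivity value `cv * Dth`).
    refine ⟨cv * Dth, mul_pos hcv hDpos, ?_⟩
    intro μ hμ
    have hDex := hR ω₂ lam β γ hω hl hβ hγ huniq μ hμ T hT
    choose D hD using hDex
    exact ⟨D, hD, hH ω₂ lam β γ hω hl hβ hγ T hT huniq μ hμ D hD Dth cv hDpos hE hcvlim⟩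
  choose κf hκpos hκ using key
  refine ⟨fun T => if hT : 0 < T then κf T hT else 1, fun T hT => ?_, ?_⟩
  · simp only [dif_pos hT]
    exact hκpos T hT
  · intro μ hμ T hT
    obtain ⟨D, hD, hlim⟩ := hκ T hT μ hμ
    refine ⟨D, hD, ?_⟩
    simp only [dif_pos hT]
    exact hlim

end Summit.AtomisticToContinuum.FouriersLaw.Theses.HeatModeWeylLaw
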